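import Summits.ValiantsHypothesis.ValiantsHypothesis.Theorems.BarrierLeverChowThinRowsSubcubePrelims

/-!
# Route BarrierLever — item `ChowHitsThinRowPartitionMinors` (stmt-ValiantsHypothesis-20195):
# products of affine forms with GENERAL `y`-coefficients and their leave-one-out coefficients
# (prelims for the all-columns first-order-rows slice, II)

Helper file (`--supports stmt-ValiantsHypothesis-20195`; cell valiant-natproofs, rung V4, 𝒟-side of
door (c); prover seat val-np-p7 gen 4).  Closes NO item; imports only the seat val-np-p4 infrastructure
files `…PartitionMinorsYOnlyFactor` / `…PartitionMinorsGenericChowProduct` (no route file); no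
definitions.  This is prover g10's `…ChowThinRowsSubcubePrelims` (p509670) with the indicator
`y`-coefficients `[c ∈ V]` replaced by an ARBITRARY coefficient vector `γ V : Fin h → ℂ` per form — the
generality needed to SCALE the non-singleton indicator forms by a parameter `ε` in the all-columns slice
(memo MEMO-CPM-s1-UDC-v6, val-np-p7 g4).

Conventions of items 19717 / 20172 / 20195: `x_a = X (castAdd h a)`, `y_c = X (natAdd h c)` in
`MvPolynomial (Fin (h+h)) ℂ`; the partition-matrix entry of `f` at `(u, w)` is `coeff (E u w) f`,
`E u w = Σ_{a ∈ u} single (castAdd h a) 1 + Σ_{c ∈ w} single (natAdd h c) 1`.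

The forms are `φ_V = C 1 + Σ_a C (κ a V) · x_a + Σ_c C (γ V c) · y_c` over a Finset `𝒦` of index sets `V`:
* `coeff_empty_mul_formG` / `coeff_single_mul_formG` — partition-coefficient recursions for appending
  one `φ_V`, at rows `∅` and `{a}` (from `ChowFactor.coeff_partitionExpo_mul_affine`);
* `coeff_empty_prod_eqG` — the `x`-parts `κ` do not affect the `x`-free coefficients;
  `coeff_empty_empty_prodG` — the constant coefficient is `1`;
* `coeff_single_prodG` — DERIVATIVE FORMULA:
  `coeff (E {a} W) ∏_𝒦 φ = Σ_{V ∈ 𝒦} κ a V · coeff (E ∅ W) ∏_{𝒦∖V} φ`;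
* `coeff_tinvG`, `coeff_tinv_mul_form0G` — the TRUNCATED INVERSE
  `t_V = Σ_{U ⊆ V} (-1)^{|U|} |U|! (∏_{c∈U} γ V c) · y^U` satisfies `t_V · φ⁰_V ≡ 1` on squarefree
  monomials when `γ V` is supported in `V`;
* `coeff_leaveOneOutG` — CLOSED FORM: for `V ∈ 𝒦`, on squarefree monomials the leave-one-out product
  `∏_{𝒦 ∖ V} φ⁰` equals `(∏_𝒦 φ⁰) · t_V`.

WHAT THIS IS NOT: bookkeeping only; nothing here on items 20195 / 20172 / 19717 themselves, on crux
stmt-ValiantsHypothesis-14610, or on `VP` versus `VNP`.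
-/

set_option linter.dupNamespace false

namespace Summit.ValiantsHypothesis.ValiantsHypothesis.Theorems.BarrierLever.ChowThinAll

open Finset MvPolynomial
open Summit.ValiantsHypothesis.ValiantsHypothesis.Theorems.BarrierLever.ChowFactor
  (coeff_partitionExpo_mul_affine coeff_partitionExpo_mul_yOnly totalDegree_affine_le)
open Summit.ValiantsHypothesis.ValiantsHypothesis.Theorems.BarrierLever.ProductStateSums
  (castAdd_ne_natAdd partitionExpo_apply_castAdd partitionExpo_apply_natAdd)
open Summit.ValiantsHypothesis.ValiantsHypothesis.Theorems.BarrierLever.CorankRepair (partitionExpo_eq_iff)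

variable {h : ℕ}

/-! ## 1. Products of the forms `φ_V = 1 + Σ_a κ_a(V) x_a + Σ_c γ_V(c) y_c` -/

/-- **Recursion for the `x`-free partition coefficients** of `F · φ_V`:
`coeff (E ∅ W) (F · φ_V) = coeff (E ∅ W) F + Σ_{c ∈ W} γ_V(c) · coeff (E ∅ (W.erase c)) F`. -/
theorem coeff_empty_mul_formG (F : MvPolynomial (Fin (h + h)) ℂ) (κV : Fin h → ℂ) (γV : Fin h → ℂ)
    (W : Finset (Fin h)) :
    coeff (∑ a ∈ (∅ : Finset (Fin h)), Finsupp.single (Fin.castAdd h a) 1 +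
        ∑ c ∈ W, Finsupp.single (Fin.natAdd h c) 1)
        (F * (C 1 + ∑ a, C (κV a) * X (Fin.castAdd h a) + ∑ c, C (γV c) * X (Fin.natAdd h c))) =
      coeff (∑ a ∈ (∅ : Finset (Fin h)), Finsupp.single (Fin.castAdd h a) 1 +
          ∑ c ∈ W, Finsupp.single (Fin.natAdd h c) 1) F +
        ∑ c ∈ W, γV c * coeff (∑ a ∈ (∅ : Finset (Fin h)), Finsupp.single (Fin.castAdd h a) 1 +
          ∑ c' ∈ W.erase c, Finsupp.single (Fin.natAdd h c') 1) F := by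
  classical
  rw [coeff_partitionExpo_mul_affine, one_mul]
  simp only [Finset.sum_empty, add_zero]

/-- **Recursion for the first-order partition coefficients**:
`coeff (E {a} W) (F · φ_V) = coeff (E {a} W) F + κ_a(V) · coeff (E ∅ W) F
  + Σ_{c ∈ W} γ_V(c) · coeff (E {a} (W.erase c)) F`. -/
theorem coeff_single_mul_formG (F : MvPolynomial (Fin (h + h)) ℂ) (κV : Fin h → ℂ) (γV : Fin h → ℂ)
    (W : Finset (Fin h)) (a : Fin h) :
    coeff (∑ a' ∈ ({a} : Finset (Fin h)), Finsupp.single (Fin.castAdd h a') 1 +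
        ∑ c ∈ W, Finsupp.single (Fin.natAdd h c) 1)
        (F * (C 1 + ∑ a, C (κV a) * X (Fin.castAdd h a) + ∑ c, C (γV c) * X (Fin.natAdd h c))) =
      coeff (∑ a' ∈ ({a} : Finset (Fin h)), Finsupp.single (Fin.castAdd h a') 1 +
          ∑ c ∈ W, Finsupp.single (Fin.natAdd h c) 1) F +
        κV a * coeff (∑ a' ∈ (∅ : Finset (Fin h)), Finsupp.single (Fin.castAdd h a') 1 +
          ∑ c ∈ W, Finsupp.single (Fin.natAdd h c) 1) F +
        ∑ c ∈ W, γV c * coeff (∑ a' ∈ ({a} : Finset (Fin h)), Finsupp.single (Fin.castAdd h a') 1 +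
          ∑ c' ∈ W.erase c, Finsupp.single (Fin.natAdd h c') 1) F := by
  classical
  rw [coeff_partitionExpo_mul_affine, one_mul]
  simp only [Finset.sum_singleton, Finset.erase_singleton, Finset.sum_empty, zero_add]

/-- The constant partition coefficient of such a product is `1`. -/
theorem coeff_empty_empty_prodG (κ : Fin h → Finset (Fin h) → ℂ) (γ : Finset (Fin h) → Fin h → ℂ)
    (𝒦 : Finset (Finset (Fin h))) :
    coeff (∑ a ∈ (∅ : Finset (Fin h)), Finsupp.single (Fin.castAdd h a) 1 +
        ∑ c ∈ (∅ : Finset (Fin h)), Finsupp.single (Fin.natAdd h c) 1)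
        (∏ V ∈ 𝒦, (C 1 + ∑ a, C (κ a V) * X (Fin.castAdd h a) + ∑ c, C (γ V c) * X (Fin.natAdd h c))) = 1 := by
  classical
  induction 𝒦 using Finset.induction_on with
  | empty =>
    rw [Finset.prod_empty]
    simp
  | insert V 𝒦 hV ih =>
    rw [Finset.prod_insert hV, mul_comm, coeff_empty_mul_formG, ih]
    simp

/-- **The `x`-parts do not affect the `x`-free partition coefficients.** -/
theorem coeff_empty_prod_eqG (κ κ' : Fin h → Finset (Fin h) → ℂ) (γ : Finset (Fin h) → Fin h → ℂ)
    (𝒦 : Finset (Finset (Fin h))) (W : Finset (Fin h)) :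
    coeff (∑ a ∈ (∅ : Finset (Fin h)), Finsupp.single (Fin.castAdd h a) 1 +
        ∑ c ∈ W, Finsupp.single (Fin.natAdd h c) 1)
        (∏ V ∈ 𝒦, (C 1 + ∑ a, C (κ a V) * X (Fin.castAdd h a) + ∑ c, C (γ V c) * X (Fin.natAdd h c))) =
      coeff (∑ a ∈ (∅ : Finset (Fin h)), Finsupp.single (Fin.castAdd h a) 1 +
          ∑ c ∈ W, Finsupp.single (Fin.natAdd h c) 1)
        (∏ V ∈ 𝒦, (C 1 + ∑ a, C (κ' a V) * X (Fin.castAdd h a) + ∑ c, C (γ V c) * X (Fin.natAdd h c))) := by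
  classical
  induction 𝒦 using Finset.induction_on generalizing W with
  | empty => rw [Finset.prod_empty, Finset.prod_empty]
  | insert V 𝒦 hV ih =>
    rw [Finset.prod_insert hV, Finset.prod_insert hV, mul_comm, coeff_empty_mul_formG,
      mul_comm, coeff_empty_mul_formG]
    simp only [ih]

/-- **Derivative formula**: the first-order coefficient `coeff (E {a} W)` of the product over `𝒦` is
`Σ_{V ∈ 𝒦} κ_a(V) · coeff (E ∅ W) (leave-V-out product)`. -/
theorem coeff_single_prodG (κ : Fin h → Finset (Fin h) → ℂ) (γ : Finset (Fin h) → Fin h → ℂ)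
    (𝒦 : Finset (Finset (Fin h))) (a : Fin h) (W : Finset (Fin h)) :
    coeff (∑ a' ∈ ({a} : Finset (Fin h)), Finsupp.single (Fin.castAdd h a') 1 +
        ∑ c ∈ W, Finsupp.single (Fin.natAdd h c) 1)
        (∏ V ∈ 𝒦, (C 1 + ∑ a, C (κ a V) * X (Fin.castAdd h a) + ∑ c, C (γ V c) * X (Fin.natAdd h c))) =
      ∑ V ∈ 𝒦, κ a V *
        coeff (∑ a' ∈ (∅ : Finset (Fin h)), Finsupp.single (Fin.castAdd h a') 1 +
            ∑ c ∈ W, Finsupp.single (Fin.natAdd h c) 1)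
          (∏ V' ∈ 𝒦.erase V, (C 1 + ∑ a, C (κ a V') * X (Fin.castAdd h a) +
            ∑ c, C (γ V' c) * X (Fin.natAdd h c))) := by
  classical
  induction 𝒦 using Finset.induction_on generalizing W with
  | empty =>
    rw [Finset.prod_empty, Finset.sum_empty, coeff_one, if_neg]
    intro h0
    have := DFunLike.congr_fun h0 (Fin.castAdd h a)
    rw [partitionExpo_apply_castAdd] at this
    simp at this
  | insert V 𝒦 hV ih =>
    rw [Finset.prod_insert hV, mul_comm, coeff_single_mul_formG, ih, Finset.sum_insert hV,
      Finset.erase_insert hV]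
    have herase : ∀ V' ∈ 𝒦, (insert V 𝒦).erase V' = insert V (𝒦.erase V') := by
      intro V' hV'
      rw [Finset.erase_insert_of_ne]
      rintro rfl
      exact hV hV'
    have hstep : ∀ V' ∈ 𝒦,
        coeff (∑ a' ∈ (∅ : Finset (Fin h)), Finsupp.single (Fin.castAdd h a') 1 +
            ∑ c ∈ W, Finsupp.single (Fin.natAdd h c) 1)
          (∏ V'' ∈ (insert V 𝒦).erase V', (C 1 + ∑ a, C (κ a V'') * X (Fin.castAdd h a) +
            ∑ c, C (γ V'' c) * X (Fin.natAdd h c))) =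
        coeff (∑ a' ∈ (∅ : Finset (Fin h)), Finsupp.single (Fin.castAdd h a') 1 +
            ∑ c ∈ W, Finsupp.single (Fin.natAdd h c) 1)
          (∏ V'' ∈ 𝒦.erase V', (C 1 + ∑ a, C (κ a V'') * X (Fin.castAdd h a) +
            ∑ c, C (γ V'' c) * X (Fin.natAdd h c))) +
        ∑ c ∈ W, γ V c * coeff (∑ a' ∈ (∅ : Finset (Fin h)), Finsupp.single (Fin.castAdd h a') 1 +
            ∑ c' ∈ W.erase c, Finsupp.single (Fin.natAdd h c') 1)
          (∏ V'' ∈ 𝒦.erase V', (C 1 + ∑ a, C (κ a V'') * X (Fin.castAdd h a) +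
            ∑ c, C (γ V'' c) * X (Fin.natAdd h c))) := by
      intro V' hV'
      have hVn : V ∉ 𝒦.erase V' := fun hm => hV (Finset.mem_of_mem_erase hm)
      rw [herase V' hV', Finset.prod_insert hVn, mul_comm, coeff_empty_mul_formG]
    have hR : (∑ V' ∈ 𝒦, κ a V' *
        coeff (∑ a' ∈ (∅ : Finset (Fin h)), Finsupp.single (Fin.castAdd h a') 1 +
            ∑ c ∈ W, Finsupp.single (Fin.natAdd h c) 1)
          (∏ V'' ∈ (insert V 𝒦).erase V', (C 1 + ∑ a, C (κ a V'') * X (Fin.castAdd h a) +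
            ∑ c, C (γ V'' c) * X (Fin.natAdd h c)))) =
        ∑ V' ∈ 𝒦, κ a V' *
          (coeff (∑ a' ∈ (∅ : Finset (Fin h)), Finsupp.single (Fin.castAdd h a') 1 +
              ∑ c ∈ W, Finsupp.single (Fin.natAdd h c) 1)
            (∏ V'' ∈ 𝒦.erase V', (C 1 + ∑ a, C (κ a V'') * X (Fin.castAdd h a) +
              ∑ c, C (γ V'' c) * X (Fin.natAdd h c))) +
          ∑ c ∈ W, γ V c * coeff (∑ a' ∈ (∅ : Finset (Fin h)), Finsupp.single (Fin.castAdd h a') 1 +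
              ∑ c' ∈ W.erase c, Finsupp.single (Fin.natAdd h c') 1)
            (∏ V'' ∈ 𝒦.erase V', (C 1 + ∑ a, C (κ a V'') * X (Fin.castAdd h a) +
              ∑ c, C (γ V'' c) * X (Fin.natAdd h c)))) :=
      Finset.sum_congr rfl fun V' hV' => by rw [hstep V' hV']
    rw [hR]
    simp only [ih, mul_add, Finset.sum_add_distrib, Finset.mul_sum]
    rw [Finset.sum_comm]
    simp only [mul_left_comm _ (κ a _) _]
    ring

/-! ## 2. The leave-one-out products of the `y`-parts: closed form via the truncated inverse -/

/-- The `y`-part `φ⁰_V = C 1 + Σ_a C 0 · x_a + Σ_c C (γ V c) · y_c` is `y`-only. -/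
theorem yOnly_form0G (γ : Finset (Fin h) → Fin h → ℂ) (V : Finset (Fin h)) :
    ∀ s ∈ (C 1 + ∑ a, C ((fun (_ : Fin h) (_ : Finset (Fin h)) => (0 : ℂ)) a V) * X (Fin.castAdd h a) +
        ∑ c, C (γ V c) * X (Fin.natAdd h c) :
          MvPolynomial (Fin (h + h)) ℂ).support, ∀ a : Fin h, s (Fin.castAdd h a) = 0 := by
  classical
  refine ChowSubcube.yOnly_add (ChowSubcube.yOnly_add ?_ ?_) ?_
  · rw [C_apply]
    exact ChowSubcube.yOnly_monomial 0 1 fun a => rfl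
  · refine ChowSubcube.yOnly_sum _ _ fun a' _ => ?_
    rw [C_0, zero_mul]
    intro s hs
    simp at hs
  · refine ChowSubcube.yOnly_sum _ _ fun c _ => ?_
    rw [C_mul_X_eq_monomial]
    refine ChowSubcube.yOnly_monomial _ _ fun a => ?_
    rw [Finsupp.single_apply, if_neg (castAdd_ne_natAdd a c).symm]

/-- Coefficients of the **truncated inverse** `t_V = Σ_{U ⊆ V} (-1)^{|U|} |U|! (∏_{c∈U} γ V c) · y^U`:
`coeff (E ∅ U') t_V = [U' ⊆ V] · (-1)^{|U'|} |U'|! ∏_{c∈U'} γ V c`. -/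
theorem coeff_tinvG (γ : Finset (Fin h) → Fin h → ℂ) (V U' : Finset (Fin h)) :
    coeff (∑ a ∈ (∅ : Finset (Fin h)), Finsupp.single (Fin.castAdd h a) 1 +
        ∑ c ∈ U', Finsupp.single (Fin.natAdd h c) 1)
        (∑ U ∈ V.powerset, monomial (∑ a ∈ (∅ : Finset (Fin h)), Finsupp.single (Fin.castAdd h a) 1 +
          ∑ c ∈ U, Finsupp.single (Fin.natAdd h c) 1)
            ((-1 : ℂ) ^ U.card * (U.card.factorial : ℂ) * ∏ c ∈ U, γ V c)) =
      if U' ⊆ V then (-1 : ℂ) ^ U'.card * (U'.card.factorial : ℂ) * ∏ c ∈ U', γ V c else 0 := by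
  classical
  rw [coeff_sum]
  simp only [coeff_monomial]
  have key : ∀ U ∈ V.powerset,
      (if (∑ a ∈ (∅ : Finset (Fin h)), Finsupp.single (Fin.castAdd h a) 1 +
            ∑ c ∈ U, Finsupp.single (Fin.natAdd h c) 1 : Fin (h + h) →₀ ℕ) =
          ∑ a ∈ (∅ : Finset (Fin h)), Finsupp.single (Fin.castAdd h a) 1 +
            ∑ c ∈ U', Finsupp.single (Fin.natAdd h c) 1
        then (-1 : ℂ) ^ U.card * (U.card.factorial : ℂ) * ∏ c ∈ U, γ V c else 0) =
      if U = U' then (-1 : ℂ) ^ U'.card * (U'.card.factorial : ℂ) * ∏ c ∈ U', γ V c else 0 := by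
    intro U _
    by_cases hU : U = U'
    · subst hU; simp
    · rw [if_neg, if_neg hU]
      intro e
      exact hU ((partitionExpo_eq_iff ∅ U ∅ U').mp e).2
  rw [Finset.sum_congr rfl key, Finset.sum_ite_eq']
  simp only [Finset.mem_powerset]

/-- The truncated inverse `t_V` is `y`-only. -/
theorem yOnly_tinvG (γ : Finset (Fin h) → Fin h → ℂ) (V : Finset (Fin h)) :
    ∀ s ∈ (∑ U ∈ V.powerset, monomial (∑ a ∈ (∅ : Finset (Fin h)), Finsupp.single (Fin.castAdd h a) 1 +
          ∑ c ∈ U, Finsupp.single (Fin.natAdd h c) 1)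
            ((-1 : ℂ) ^ U.card * (U.card.factorial : ℂ) * ∏ c ∈ U, γ V c) :
        MvPolynomial (Fin (h + h)) ℂ).support, ∀ a : Fin h, s (Fin.castAdd h a) = 0 := by
  classical
  refine ChowSubcube.yOnly_sum _ _ fun U _ => ChowSubcube.yOnly_monomial _ _ fun a => ?_
  rw [partitionExpo_apply_castAdd]
  simp

/-- **`t_V · φ⁰_V ≡ 1` on squarefree monomials** when `γ V` is supported in `V`:
`coeff (E ∅ U) (t_V · φ⁰_V) = [U = ∅]` (the identity `(-1)^n n! + n · (-1)^{n-1} (n-1)! = 0`). -/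
theorem coeff_tinv_mul_form0G (γ : Finset (Fin h) → Fin h → ℂ) (V : Finset (Fin h))
    (hγ : ∀ c, c ∉ V → γ V c = 0) (U : Finset (Fin h)) :
    coeff (∑ a ∈ (∅ : Finset (Fin h)), Finsupp.single (Fin.castAdd h a) 1 +
        ∑ c ∈ U, Finsupp.single (Fin.natAdd h c) 1)
        ((∑ U ∈ V.powerset, monomial (∑ a ∈ (∅ : Finset (Fin h)), Finsupp.single (Fin.castAdd h a) 1 +
            ∑ c ∈ U, Finsupp.single (Fin.natAdd h c) 1)
            ((-1 : ℂ) ^ U.card * (U.card.factorial : ℂ) * ∏ c ∈ U, γ V c)) *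
          (C 1 + ∑ a, C ((fun (_ : Fin h) (_ : Finset (Fin h)) => (0 : ℂ)) a V) * X (Fin.castAdd h a) +
            ∑ c, C (γ V c) * X (Fin.natAdd h c))) =
      if U = ∅ then 1 else 0 := by
  classical
  rw [coeff_empty_mul_formG, coeff_tinvG]
  simp only [coeff_tinvG]
  by_cases hU0 : U = ∅
  · subst hU0
    simp
  rw [if_neg hU0]
  by_cases hUV : U ⊆ V
  · rw [if_pos hUV]
    have hterm : ∀ c ∈ U, γ V c *
        (if U.erase c ⊆ V then (-1 : ℂ) ^ (U.erase c).card * ((U.erase c).card.factorial : ℂ) *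
          ∏ c' ∈ U.erase c, γ V c' else 0) =
          (-1 : ℂ) ^ (U.card - 1) * ((U.card - 1).factorial : ℂ) * ∏ c' ∈ U, γ V c' := by
      intro c hc
      rw [if_pos ((Finset.erase_subset c U).trans hUV), Finset.card_erase_of_mem hc,
        ← Finset.prod_erase_mul U (fun c' => γ V c') hc]
      ring
    rw [Finset.sum_congr rfl hterm, Finset.sum_const]
    obtain ⟨n, hn⟩ : ∃ n, U.card = n + 1 := ⟨U.card - 1, by
      have := Finset.card_pos.mpr (Finset.nonempty_iff_ne_empty.mpr hU0); omega⟩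
    rw [hn, Nat.add_sub_cancel, Nat.factorial_succ, nsmul_eq_mul]
    push_cast
    ring
  · rw [if_neg hUV, zero_add]
    refine Finset.sum_eq_zero fun c hc => ?_
    by_cases hsub : U.erase c ⊆ V
    · have hcV : c ∉ V := by
        intro hcV
        apply hUV
        intro x hx
        by_cases hxc : x = c
        · rw [hxc]; exact hcV
        · exact hsub (Finset.mem_erase.mpr ⟨hxc, hx⟩)
      rw [hγ c hcV, zero_mul]
    · rw [if_neg hsub, mul_zero]

/-- **Closed form for the leave-one-out products** (`E_V = B · t_V` on squarefree monomials): for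
`V ∈ 𝒦` with `γ V` supported in `V`,
`coeff (E ∅ W) (∏_{𝒦 ∖ V} φ⁰) = Σ_{U ⊆ W} coeff (E ∅ (W ∖ U)) (∏_𝒦 φ⁰) · coeff (E ∅ U) t_V`. -/
theorem coeff_leaveOneOutG (γ : Finset (Fin h) → Fin h → ℂ) (𝒦 : Finset (Finset (Fin h)))
    (V : Finset (Fin h)) (hV : V ∈ 𝒦) (hγ : ∀ c, c ∉ V → γ V c = 0) (W : Finset (Fin h)) :
    coeff (∑ a ∈ (∅ : Finset (Fin h)), Finsupp.single (Fin.castAdd h a) 1 +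
        ∑ c ∈ W, Finsupp.single (Fin.natAdd h c) 1)
        (∏ V' ∈ 𝒦.erase V, (C 1 + ∑ a, C ((fun (_ : Fin h) (_ : Finset (Fin h)) => (0 : ℂ)) a V') *
            X (Fin.castAdd h a) + ∑ c, C (γ V' c) * X (Fin.natAdd h c))) =
      ∑ U ∈ W.powerset,
        coeff (∑ a ∈ (∅ : Finset (Fin h)), Finsupp.single (Fin.castAdd h a) 1 +
            ∑ c ∈ W \ U, Finsupp.single (Fin.natAdd h c) 1)
          (∏ V' ∈ 𝒦, (C 1 + ∑ a, C ((fun (_ : Fin h) (_ : Finset (Fin h)) => (0 : ℂ)) a V') *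
            X (Fin.castAdd h a) + ∑ c, C (γ V' c) * X (Fin.natAdd h c))) *
        coeff (∑ a ∈ (∅ : Finset (Fin h)), Finsupp.single (Fin.castAdd h a) 1 +
            ∑ c ∈ U, Finsupp.single (Fin.natAdd h c) 1)
          (∑ U' ∈ V.powerset, monomial (∑ a ∈ (∅ : Finset (Fin h)), Finsupp.single (Fin.castAdd h a) 1 +
            ∑ c ∈ U', Finsupp.single (Fin.natAdd h c) 1)
            ((-1 : ℂ) ^ U'.card * (U'.card.factorial : ℂ) * ∏ c ∈ U', γ V c)) := by
  classical
  rw [← coeff_partitionExpo_mul_yOnly _ _ (yOnly_tinvG γ V) ∅ W]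
  rw [← Finset.prod_erase_mul 𝒦 _ hV, mul_assoc, mul_comm (C 1 + _ + _),
    coeff_partitionExpo_mul_yOnly _ _ (ChowSubcube.yOnly_mul (yOnly_tinvG γ V) (yOnly_form0G γ V)) ∅ W]
  simp_rw [coeff_tinv_mul_form0G γ V hγ, mul_ite, mul_one, mul_zero]
  rw [Finset.sum_ite_eq', if_pos (Finset.empty_mem_powerset W), Finset.sdiff_empty]

end Summit.ValiantsHypothesis.ValiantsHypothesis.Theorems.BarrierLever.ChowThinAll
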